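import Summits.FinalStateConjecture.Statement
import Literature.Geometry.Lorentzian.TameGenericityDiagonal
import HarnessLib

/-!
# Crux `SettlingAlongCensoredKerrEnds` (stmt-FinalStateConjecture-18520), line `wall-cone-sections`:
# the settled-wedge stub W follows from MEMBER-WISE settledness (an upper bound on its strength)

Line lead, cycle 1 (2026-08-17). The registered stub of the line is W =
`stub_settledWedgeInKickUnfolding` (`Cruxes/SettlingAlongCensoredKerrEnds/Lines/wall_cone_sections.lean`;
`W → C₂` is `settlingAlongCensoredKerrEnds_of_settledWedge`, p166318). This file lands one
consistency fact about the reshaped signature — no dynamics: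

* `settledWedge_of_settledMembers` — if the members `F c`, `c ≠ 0`, of a tame admissible curve are
  themselves SETTLED (the Statement's clause for every maximal development, verbatim), the
  conclusion of W holds for `F` with the `s`-independent unfolding `G (t, s) := F t` (tame as a
  two-parameter family by `IsTameDataFamily.comp_contDiff` along the projection `p ↦ (p 0) • e₀`),
  slope `K = 0` and the unit box: every wedge member is some `F t`, `t > 0`. So W asks NOTHING
  beyond the Statement's own clause at the members off `0` — it is non-trivial exactly along curves
  running inside the exceptional set, where the kick must do the work — and in particular W holds
  along every curve handed back by the crux itself.

References: Christodoulou, CQG 16 (1999) A23, p. A24 and Ann. Math. 149 (1999), p. 187 (lines and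
planes `α₀ + λ₁ f₁ + λ₂ f₂` in a fixed space of data); Dafermos–Rodnianski arXiv:0811.0354, App. B.2.3.
-/

-- the doubled `FinalStateConjecture.FinalStateConjecture` path component trips dupNamespace
set_option linter.dupNamespace false

noncomputable section

open Set Function Filter TopologicalSpace
open scoped Manifold ContDiff Topology NNReal

namespace Summit.FinalStateConjecture.FinalStateConjecture.Theorems.ExactKerrEnds

open Literature.Geometry.Lorentzian
open Summit.FinalStateConjecture (HasCompleteNullInfinity exteriorOf RaysStayInClosure HasExhaustiveCharts
  IsFutureOriented)

/-! ### W from member-wise settledness -/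

/-- **If the members off `0` of a tame admissible curve are settled, the settled-wedge conclusion of
stub W holds for it** with the `s`-independent unfolding `G (t, s) := F t`, slope `K = 0`,
`t₁ = b₀ = 1`: the unfolding is tame (`IsTameDataFamily.comp_contDiff` along
`p ↦ (p 0) • e₀`), agrees with `F` on the axis, is admissible, and a wedge member
`G (t, s) = F (t • e₀)` with `t > 0` is a member of `F` off `0`. [folklore] -/
theorem settledWedge_of_settledMembers :
    ∀ (X : Type) [TopologicalSpace X] [ChartedSpace E3 X] [IsManifold (𝓡 3) ∞ X] [ConnectedSpace X]
      (e : AFEnd X) (F : EuclideanSpace ℝ (Fin 1) → InitialDataSet (𝓡 3) X),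
      InitialDataSet.IsTameDataFamily e 1 F →
        (∀ c, F c ∈ admissibleVacuumData X) →
          (∀ c ≠ 0, ∀ 𝒟 : VacuumCauchyDevelopment (F c), 𝒟.IsMaximal →
            HasCompleteNullInfinity 𝒟.toCauchyDevelopment ∧
              ∃ (O : Set 𝒟.carrier) (d : FinalStateDecomposition 𝒟.toSpacetime O 2),
                (∀ i, Kerr.IsSubextremal (d.mass i) (d.spin i)) ∧
                  O = exteriorOf 𝒟.toCauchyDevelopment d.charted ∧
                    RaysStayInClosure 𝒟.toCauchyDevelopment O ∧ HasExhaustiveCharts d ∧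
                      IsFutureOriented d) →
            ∃ (e' : AFEnd X) (G : EuclideanSpace ℝ (Fin 2) → InitialDataSet (𝓡 3) X) (K : ℝ≥0)
              (t₁ b₀ : ℝ),
              InitialDataSet.IsTameDataFamily e' 2 G ∧
                (∀ c : EuclideanSpace ℝ (Fin 1),
                  G ((c 0) • EuclideanSpace.single 0 (1 : ℝ) + (0 : ℝ) • EuclideanSpace.single 1 (1 : ℝ)) =
                    F c) ∧
                (∀ p, G p ∈ admissibleVacuumData X) ∧ 0 < t₁ ∧ 0 < b₀ ∧
                ∀ t ∈ Ioc (0 : ℝ) t₁, ∀ s : ℝ, (K : ℝ) * t < s → s < b₀ →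
                  ∀ 𝒟 : VacuumCauchyDevelopment
                      (G (t • EuclideanSpace.single 0 (1 : ℝ) + s • EuclideanSpace.single 1 (1 : ℝ))),
                    𝒟.IsMaximal →
                      HasCompleteNullInfinity 𝒟.toCauchyDevelopment ∧
                        ∃ (O : Set 𝒟.carrier) (d : FinalStateDecomposition 𝒟.toSpacetime O 2),
                          (∀ i, Kerr.IsSubextremal (d.mass i) (d.spin i)) ∧
                            O = exteriorOf 𝒟.toCauchyDevelopment d.charted ∧
                              RaysStayInClosure 𝒟.toCauchyDevelopment O ∧ HasExhaustiveCharts d ∧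
                                IsFutureOriented d := by
  intro X _ _ _ _ e F hF hadm hS
  -- the projection of the parameter plane onto its first axis, as a map `ℝ² → ℝ¹`
  let π : EuclideanSpace ℝ (Fin 2) → EuclideanSpace ℝ (Fin 1) := fun p ↦
    (p 0) • EuclideanSpace.single 0 (1 : ℝ)
  have hπ : ContDiff ℝ ∞ π :=
    (EuclideanSpace.proj (0 : Fin 2) : EuclideanSpace ℝ (Fin 2) →L[ℝ] ℝ).contDiff.smul contDiff_const
  have hπ0 : π 0 = 0 := by simp [π]
  -- a point of `ℝ¹` is determined by its coordinate
  have hsingle : ∀ c : EuclideanSpace ℝ (Fin 1), (c 0) • EuclideanSpace.single 0 (1 : ℝ) = c := by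
    intro c
    ext i
    rw [Subsingleton.elim i 0]
    simp
  have hπaxis : ∀ t s : ℝ,
      π (t • EuclideanSpace.single 0 (1 : ℝ) + s • EuclideanSpace.single 1 (1 : ℝ)) =
        t • EuclideanSpace.single 0 (1 : ℝ) := by
    intro t s
    simp [π]
  refine ⟨e, fun p ↦ F (π p), 0, 1, 1, hF.comp_contDiff hπ hπ0, fun c ↦ ?_, fun p ↦ hadm _,
    one_pos, one_pos, fun t ht s _ _ ↦ ?_⟩
  · show F (π _) = F c
    rw [hπaxis, hsingle]
  · have hne : t • EuclideanSpace.single (0 : Fin 1) (1 : ℝ) ≠ 0 := by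
      intro h
      have := congrArg (fun v : EuclideanSpace ℝ (Fin 1) ↦ v 0) h
      simp only [PiLp.smul_apply, PiLp.single_apply, if_true, smul_eq_mul, mul_one,
        PiLp.zero_apply] at this
      exact absurd this ht.1.ne'
    have key : ∀ a : EuclideanSpace ℝ (Fin 1), a = t • EuclideanSpace.single 0 (1 : ℝ) →
        ∀ 𝒟 : VacuumCauchyDevelopment (F a), 𝒟.IsMaximal →
          HasCompleteNullInfinity 𝒟.toCauchyDevelopment ∧
            ∃ (O : Set 𝒟.carrier) (d : FinalStateDecomposition 𝒟.toSpacetime O 2),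
              (∀ i, Kerr.IsSubextremal (d.mass i) (d.spin i)) ∧
                O = exteriorOf 𝒟.toCauchyDevelopment d.charted ∧
                  RaysStayInClosure 𝒟.toCauchyDevelopment O ∧ HasExhaustiveCharts d ∧
                    IsFutureOriented d := by
      rintro a rfl
      exact hS _ hne
    exact key _ (hπaxis t s)

end Summit.FinalStateConjecture.FinalStateConjecture.Theorems.ExactKerrEnds

end
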